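import Literature.NumberTheory.PAdicHodge.TateSenConditionCompletedAlgClosure
import Literature.NumberTheory.PAdicHodge.TateInvariantsBase
import HarnessLib

/-!
# The Tate–Sen condition (TS1) for `ℂ_F` from Tate's almost étale lemma (Prop. 9) — the bridge
# (Tate 1967 §3.2 Prop. 9 ⇒ Berger–Colmez Déf. 3.1.3 (TS1), Prop. 4.1.1)

Notation of `TateSenConditionCompletedAlgClosure`: `K₀ = PadicBase F p hp ≅ ℚ_p`,
`F̄ = NormedAlgClosure F`, `G₀ = Gal(F̄/K₀)` (Krull topology), `H₀ = ker χ = Gal(F̄/K_∞)`,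
`K_∞ = TateTrace.Kinf hp = K₀(μ_{p^∞})`, `ℂ_F = CompletedAlgClosure F`. The tree's cite-only named fact
`tate1967_TS1_completedAlgClosure` is a statement about OPEN SUBGROUPS `H₁ ≤ H₂` of `H₀` and sums
`Σ_{s ∈ S} s • α` over systems of representatives of `H₂/H₁`. Tate's Prop. 9 is a statement about
TRACES of finite extensions `L₁ ⊇ L₂ ⊇ K_∞`. This file proves the Galois-theoretic bridge:

* `TateAlmostEtale.sum_smul_eq_trace` : **trace = sum over coset representatives** — for
  `K₀ ⊆ M ⊆ L ⊆ F̄` with `L/M` finite, `y ∈ L`, and a finite `S ⊆ Fix(M) ≤ G₀` meeting every left coset of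
  `Fix(L)` in `Fix(M)` exactly once, `Σ_{s ∈ S} s • y = Tr_{L/M}(y)` (Mathlib `trace_eq_sum_embeddings` and the
  bijection `S ≃ (L →ₐ[M] F̄)`, surjective by `AlgHom.liftNormal`);
* `TateAlmostEtale.finiteDimensional_of_reps` : such an `L = F̄^{H₁}` is finite over `M = F̄^{H₂}` as soon as
  `H₂/H₁` has a finite system of representatives (closed subgroup of finite index is open; Mathlib
  `InfiniteGalois.isOpen_iff_finite`);
* `TateAlmostEtale.TS1_of_almostEtale` : **(TS1) for `ℂ_F` (for the given `F`, `p`) follows from Tate's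
  almost étale lemma in `ε`-form** — `∀ L₂ ≤ L₁` intermediate fields containing `K_∞` with `L₁/L₂` finite,
  `∃ y ∈ L₁, Tr_{L₁/L₂}(y) = 1, ‖y‖ ≤ ‖p‖⁻¹` — with the constant `K = ‖p‖⁻¹`.

Together with the elementary Kummer-route files (`TateAlmostEtaleKummerStep`, `TateAlmostEtalePackageStep`, …)
this reduces the named fact to Prop. 9 for all finite `L₁ ⊇ L₂ ⊇ K_∞`. No `sorry`, no definitions;
BSD is not proved by any of this.

References: [Tate1967] §3.2 Prop. 9; [BergerColmez2008] Déf. 3.1.3 (TS1), Prop. 4.1.1.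
-/

noncomputable section

open Field ValuativeRel IntermediateField

namespace Literature.NumberTheory.PAdicHodge

namespace TateAlmostEtale

open Literature.NumberTheory.GaloisRepresentations
open Literature.NumberTheory.GaloisRepresentations.IsNonarchimedeanLocalField

variable {F : Type} [Field F] [ValuativeRel F] [TopologicalSpace F] [IsNonarchimedeanLocalField F]
  [CharZero F] {p : ℕ} [Fact p.Prime] (hp : valuation F p < 1)

/-! ### §1 Trace = sum over coset representatives -/

section TraceSum

variable (M : IntermediateField (PadicBase F p hp) (NormedAlgClosure F))
  (L : IntermediateField M (NormedAlgClosure F)) [FiniteDimensional M L]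

omit [FiniteDimensional M L] in
/-- `L/M` is separable (characteristic zero). [folklore] -/
private theorem isSeparable_L' : Algebra.IsSeparable M L := by
  haveI : CharZero M :=
    charZero_of_injective_algebraMap (algebraMap (PadicBase F p hp) M).injective
  exact Algebra.IsAlgebraic.isSeparable_of_perfectField

/-- **Trace = sum over coset representatives.** Let `K₀ ⊆ M ⊆ L ⊆ F̄` with `L/M` finite, `y ∈ L`, and
`S ⊆ G₀` a finite set of elements fixing `M` pointwise such that every `h ∈ G₀` fixing `M` pointwise has
exactly one `s ∈ S` with `s⁻¹ h` fixing `L` pointwise (a system of representatives of `Fix(M)/Fix(L)`).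
Then `Σ_{s ∈ S} s • y = Tr_{L/M}(y)`: the restrictions `s|_L` are exactly the `M`-embeddings `L → F̄`
(injective by uniqueness of representatives, surjective by `AlgHom.liftNormal`), and
`Tr = Σ_σ σ` (Mathlib `trace_eq_sum_embeddings`). [cite: Tate1967, §3.2] [cite: BergerColmez2008, Lemme 3.2.1] -/
theorem sum_smul_eq_trace (S : Finset (BaseGaloisGroup hp)) (hSM : ∀ s ∈ S, ∀ y ∈ M, s • y = y)
    (hrep : ∀ h : BaseGaloisGroup hp, (∀ y ∈ M, h • y = y) →
      ∃! s, s ∈ S ∧ ∀ z ∈ L, (s⁻¹ * h) • z = z)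
    (y : L) :
    ∑ s ∈ S, s • (y : NormedAlgClosure F) = ((Algebra.trace M L y : M) : NormedAlgClosure F) := by
  classical
  haveI := isSeparable_L' hp M L
  have htr := trace_eq_sum_embeddings (NormedAlgClosure F) (K := M) (L := L) (x := y)
  rw [IntermediateField.algebraMap_apply] at htr
  rw [htr]
  -- the restriction of `s ∈ S` to `L`, as an `M`-embedding
  have hcomm : ∀ s ∈ S, ∀ (c : M) (z : L),
      (s.toRingEquiv.toRingHom.comp (algebraMap L (NormedAlgClosure F))) (c • z) =
      c • (s.toRingEquiv.toRingHom.comp (algebraMap L (NormedAlgClosure F))) z := by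
    intro s hs c z
    change s ((c • z : L) : NormedAlgClosure F) = c • s (z : NormedAlgClosure F)
    rw [Algebra.smul_def, Algebra.smul_def, IntermediateField.algebraMap_apply]
    push_cast
    rw [map_mul]
    congr 1
    exact hSM s hs _ c.2
  let emb : ∀ s ∈ S, (L →ₐ[M] NormedAlgClosure F) := fun s hs =>
    AlgHom.mk' (s.toRingEquiv.toRingHom.comp (algebraMap L (NormedAlgClosure F))) (hcomm s hs)
  have hemb : ∀ s (hs : s ∈ S) (z : L), emb s hs z = s • (z : NormedAlgClosure F) := fun s hs z => rfl
  refine Finset.sum_bij emb (fun s hs => Finset.mem_univ _) ?_ ?_ (fun s hs => (hemb s hs y).symm)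
  · -- injectivity: two representatives with the same restriction to `L` are equal
    intro s₁ hs₁ s₂ hs₂ heq
    obtain ⟨s, -, huniq⟩ := hrep s₁ (hSM s₁ hs₁)
    have h1 : s₁ = s := huniq s₁ ⟨hs₁, fun z _ => by rw [inv_mul_cancel, one_smul]⟩
    have h2 : s₂ = s := huniq s₂ ⟨hs₂, fun z hz => by
      have := congrArg (fun φ : L →ₐ[M] NormedAlgClosure F => φ ⟨z, hz⟩) heq
      simp only [hemb] at this
      rw [mul_smul, this, ← mul_smul, inv_mul_cancel, one_smul]⟩
    rw [h1, h2]
  · -- surjectivity: every `M`-embedding extends to an automorphism of `F̄` fixing `M`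
    intro σ _
    haveI : Normal M (NormedAlgClosure F) := IsAlgClosure.normal _ _
    let τ : NormedAlgClosure F →ₐ[M] NormedAlgClosure F := σ.liftNormal (NormedAlgClosure F)
    let τ' : NormedAlgClosure F ≃ₐ[M] NormedAlgClosure F :=
      AlgEquiv.ofBijective τ (AlgHom.normal_bijective M _ _ τ)
    set g : BaseGaloisGroup hp := τ'.restrictScalars (PadicBase F p hp) with hg
    have hgM : ∀ y ∈ M, g • y = y := fun y hy => τ'.commutes ⟨y, hy⟩
    have hgσ : ∀ z : L, g • (z : NormedAlgClosure F) = σ z := by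
      intro z
      change τ (z : NormedAlgClosure F) = σ z
      have := σ.liftNormal_commutes (NormedAlgClosure F) z
      rw [IntermediateField.algebraMap_apply] at this
      exact this
    obtain ⟨s, ⟨hs, hsg⟩, -⟩ := hrep g hgM
    refine ⟨s, hs, ?_⟩
    apply AlgHom.ext
    intro z
    rw [hemb s hs, ← hgσ]
    have := hsg z z.2
    rw [mul_smul] at this
    -- `s⁻¹ • (g • z) = z` ⇒ `g • z = s • z`
    have h2 := congrArg (fun w => s • w) this
    simp only [smul_inv_smul] at h2
    exact h2.symm

end TraceSum

/-! ### §2 Finite index ⇒ finite degree -/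

section Finite

variable (M : IntermediateField (PadicBase F p hp) (NormedAlgClosure F))
  (L : IntermediateField M (NormedAlgClosure F))

/-- **A finite system of representatives forces finite degree.** If some finite `S ⊆ G₀` meets every
coset of `Fix(L)` in `Fix(M)` (every `h ∈ G₀` fixing `M` pointwise has some `s ∈ S` with `s⁻¹ h` fixing `L`
pointwise), then `L/M` is finite: `Fix(L)` is a closed subgroup of finite index of `Gal(F̄/M)`, hence open,
and open subgroups have finite-dimensional fixed fields (Mathlib `InfiniteGalois.isOpen_iff_finite`).
[cite: Tate1967, §3.2] [cite: BergerColmez2008, Déf. 3.1.3] -/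
theorem finiteDimensional_of_reps (S : Finset (BaseGaloisGroup hp)) (hSM : ∀ s ∈ S, ∀ y ∈ M, s • y = y)
    (hrep : ∀ h : BaseGaloisGroup hp, (∀ y ∈ M, h • y = y) →
      ∃ s, s ∈ S ∧ ∀ z ∈ L, (s⁻¹ * h) • z = z) :
    FiniteDimensional M L := by
  classical
  haveI : IsGalois (PadicBase F p hp) (NormedAlgClosure F) := inferInstance
  haveI : IsGalois M (NormedAlgClosure F) :=
    IsGalois.tower_top_of_isGalois (PadicBase F p hp) M (NormedAlgClosure F)
  set H : Subgroup (NormedAlgClosure F ≃ₐ[M] NormedAlgClosure F) := L.fixingSubgroup with hH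
  -- every coset of `H` is represented by some `s ∈ S`, viewed in `Gal(F̄/M)`
  have hSfix : ∀ s ∈ S, s ∈ M.fixingSubgroup := fun s hs =>
    (IntermediateField.mem_fixingSubgroup_iff M s).mpr (hSM s hs)
  let lift : S → NormedAlgClosure F ≃ₐ[M] NormedAlgClosure F :=
    fun s => IntermediateField.fixingSubgroupEquiv M ⟨s.1, hSfix s.1 s.2⟩
  have hlift : ∀ (s : S) (x : NormedAlgClosure F), lift s x = (s.1 : BaseGaloisGroup hp) • x :=
    fun s x => rfl
  haveI : Finite ((NormedAlgClosure F ≃ₐ[M] NormedAlgClosure F) ⧸ H) := by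
    refine Finite.of_surjective (fun s : S => (QuotientGroup.mk (lift s) : _ ⧸ H)) ?_
    intro q
    induction q using QuotientGroup.induction_on with
    | H σ =>
      have hσM : ∀ y ∈ M, (σ.restrictScalars (PadicBase F p hp) : BaseGaloisGroup hp) • y = y :=
        fun y hy => σ.commutes ⟨y, hy⟩
      obtain ⟨s, hs, hsσ⟩ := hrep (σ.restrictScalars (PadicBase F p hp)) hσM
      refine ⟨⟨s, hs⟩, ?_⟩
      rw [QuotientGroup.eq, hH, IntermediateField.mem_fixingSubgroup_iff]
      intro z hz
      -- `(lift s)⁻¹ σ z = z` since `s⁻¹ σ` fixes `L`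
      have h1 := hsσ z hz
      rw [mul_smul] at h1
      change (lift ⟨s, hs⟩).symm (σ z) = z
      rw [AlgEquiv.symm_apply_eq]
      change (AlgEquiv.restrictScalars (PadicBase F p hp) σ : BaseGaloisGroup hp) • z =
        (s : BaseGaloisGroup hp) • z
      have h2 := congrArg (fun w => (s : BaseGaloisGroup hp) • w) h1
      simp only [smul_inv_smul] at h2
      exact h2
  haveI : H.FiniteIndex := Subgroup.finiteIndex_of_finite_quotient
  have hopen : IsOpen (H : Set (NormedAlgClosure F ≃ₐ[M] NormedAlgClosure F)) :=
    Subgroup.isOpen_of_isClosed_of_finiteIndex H (hH ▸ InfiniteGalois.fixingSubgroup_isClosed L)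
  exact (InfiniteGalois.isOpen_iff_finite L).mp hopen

end Finite

/-! ### §3 (TS1) for `ℂ_F` from the almost étale lemma -/

section TS1

/-- **The Tate–Sen condition (TS1) for `ℂ_F` from Tate's almost étale lemma.** Suppose Tate's Prop. 9 in
the form: for all intermediate fields `K_∞ ⊆ L₂ ⊆ F̄` and finite `L₁/L₂` inside `F̄` there is `y ∈ L₁` with
`Tr_{L₁/L₂}(y) = 1` and `‖y‖ ≤ ‖p‖⁻¹`. Then for all open subgroups `H₁ ≤ H₂` of `H₀ = ker χ ≤ G₀` and every
finite system `S ⊆ H₂` of representatives of `H₂/H₁` there is `α ∈ ℂ_F` fixed by `H₁` with `‖α‖ ≤ ‖p‖⁻¹` and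
`Σ_{s ∈ S} s • α = 1` — i.e. the `F`-instance of `tate1967_TS1_completedAlgClosure` with `K = ‖p‖⁻¹`. Proof:
`L_i = F̄^{H_i}` (closed subgroups, infinite Galois correspondence), `L₁/L₂` finite
(`finiteDimensional_of_reps`), `α = y` and `Σ_{s ∈ S} s • y = Tr(y) = 1` (`sum_smul_eq_trace`).
[cite: Tate1967, §3.2 Prop. 9] [cite: BergerColmez2008, Déf. 3.1.3, Prop. 4.1.1] -/
theorem TS1_of_almostEtale
    (h9 : ∀ (L₂ : IntermediateField (PadicBase F p hp) (NormedAlgClosure F))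
      (L₁ : IntermediateField L₂ (NormedAlgClosure F)), TateTrace.Kinf hp ≤ L₂ →
      FiniteDimensional L₂ L₁ → ∃ y : L₁, Algebra.trace L₂ L₁ y = 1 ∧
        ‖(y : NormedAlgClosure F)‖ ≤ ‖(p : NormedAlgClosure F)‖⁻¹) :
    ∃ K : ℝ, ∀ (H₁ H₂ : OpenSubgroup (BaseGaloisGroup.baseCyclotomicCharacter hp).ker), H₁ ≤ H₂ →
      ∀ S : Finset (BaseGaloisGroup.baseCyclotomicCharacter hp).ker,
        (∀ s ∈ S, s ∈ H₂) → (∀ h ∈ H₂, ∃! s, s ∈ S ∧ s⁻¹ * h ∈ H₁) →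
        ∃ α : CompletedAlgClosure F, (∀ u ∈ H₁, u • α = α) ∧ ‖α‖ ≤ K ∧ ∑ s ∈ S, s • α = 1 := by
  classical
  haveI : IsGalois (PadicBase F p hp) (NormedAlgClosure F) := inferInstance
  set Hk := (BaseGaloisGroup.baseCyclotomicCharacter hp).ker with hHk
  refine ⟨‖(p : NormedAlgClosure F)‖⁻¹, fun H₁ H₂ h12 S hS hrep => ?_⟩
  -- the subgroups in `G₀` and their fixed fields
  set H₁' : Subgroup (BaseGaloisGroup hp) := H₁.toSubgroup.map Hk.subtype with hH₁'
  set H₂' : Subgroup (BaseGaloisGroup hp) := H₂.toSubgroup.map Hk.subtype with hH₂'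
  have h12' : H₁' ≤ H₂' := Subgroup.map_mono h12
  -- closedness: `Hk` is closed in `G₀`, `H_i` are closed in `Hk`
  have hHkcl : IsClosed (Hk : Set (BaseGaloisGroup hp)) := by
    have h : (Hk : Set (BaseGaloisGroup hp)) = (BaseGaloisGroup.baseCyclotomicCharacter hp) ⁻¹' {1} := by
      ext g; exact MonoidHom.mem_ker
    rw [h]
    exact isClosed_singleton.preimage
      (cyclotomicCharacter.continuous p (PadicBase F p hp) (NormedAlgClosure F))
  have hclosed : ∀ H : OpenSubgroup Hk, IsClosed ((H.toSubgroup.map Hk.subtype : Subgroup _) :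
      Set (BaseGaloisGroup hp)) := by
    intro H
    have h1 : IsClosed (H : Set Hk) := H.isClosed
    have h2 : ((H.toSubgroup.map Hk.subtype : Subgroup (BaseGaloisGroup hp)) : Set (BaseGaloisGroup hp)) =
        ((↑) : Hk → BaseGaloisGroup hp) '' (H : Set Hk) := by
      ext g; simp
    rw [h2]
    exact (hHkcl.isClosedEmbedding_subtypeVal.isClosedMap) _ h1
  set L₂ : IntermediateField (PadicBase F p hp) (NormedAlgClosure F) := fixedField H₂' with hL₂
  set L₁E : IntermediateField (PadicBase F p hp) (NormedAlgClosure F) := fixedField H₁' with hL₁E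
  have hle : L₂ ≤ L₁E := IntermediateField.fixedField_le h12'
  set L₁ : IntermediateField L₂ (NormedAlgClosure F) := extendScalars hle with hL₁
  have hfix₂ : L₂.fixingSubgroup = H₂' :=
    InfiniteGalois.fixingSubgroup_fixedField ⟨H₂', hclosed H₂⟩
  have hfix₁ : L₁E.fixingSubgroup = H₁' :=
    InfiniteGalois.fixingSubgroup_fixedField ⟨H₁', hclosed H₁⟩
  -- `K_∞ ≤ L₂`
  have hKinf : TateTrace.Kinf hp ≤ L₂ := by
    intro x hx
    rw [hL₂, IntermediateField.mem_fixedField_iff]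
    rintro g ⟨g₀, -, rfl⟩
    have hg₀ : (g₀ : BaseGaloisGroup hp) ∈ Hk := g₀.2
    rw [TateSen.mem_baseKer_iff_forall_smul_zeta] at hg₀
    exact (TateTrace.forall_mem_Kinf_smul_eq_iff hp _).mpr hg₀ x hx
  -- the system of representatives in `G₀`
  set S' : Finset (BaseGaloisGroup hp) := S.map ⟨((↑) : Hk → BaseGaloisGroup hp), Subtype.val_injective⟩
    with hS'
  have hS'M : ∀ s ∈ S', ∀ y ∈ L₂, s • y = y := by
    intro s hs y hy
    obtain ⟨s₀, hs₀, rfl⟩ := Finset.mem_map.mp hs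
    have : ((s₀ : BaseGaloisGroup hp)) ∈ H₂' := ⟨s₀, hS s₀ hs₀, rfl⟩
    rw [hL₂, IntermediateField.mem_fixedField_iff] at hy
    exact hy _ this
  have hrep' : ∀ h : BaseGaloisGroup hp, (∀ y ∈ L₂, h • y = y) →
      ∃! s, s ∈ S' ∧ ∀ z ∈ L₁, (s⁻¹ * h) • z = z := by
    intro h hh
    have hh2 : h ∈ H₂' := by
      rw [← hfix₂, IntermediateField.mem_fixingSubgroup_iff]; exact hh
    obtain ⟨h₀, hh₀, rfl⟩ := hh2
    obtain ⟨s, ⟨hsS, hs⟩, huniq⟩ := hrep h₀ hh₀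
    refine ⟨(s : BaseGaloisGroup hp), ⟨Finset.mem_map.mpr ⟨s, hsS, rfl⟩, ?_⟩, ?_⟩
    · intro z hz
      have hmem : ((s⁻¹ * h₀ : Hk) : BaseGaloisGroup hp) ∈ H₁' := ⟨s⁻¹ * h₀, hs, rfl⟩
      rw [← hfix₁, IntermediateField.mem_fixingSubgroup_iff] at hmem
      exact hmem z hz
    · intro t ⟨ht, htfix⟩
      obtain ⟨t₀, ht₀, rfl⟩ := Finset.mem_map.mp ht
      have hmem : ((t₀⁻¹ * h₀ : Hk) : BaseGaloisGroup hp) ∈ L₁E.fixingSubgroup := by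
        rw [IntermediateField.mem_fixingSubgroup_iff]
        intro z hz; exact htfix z hz
      rw [hfix₁] at hmem
      obtain ⟨u, hu, hu'⟩ := hmem
      have : u = t₀⁻¹ * h₀ := Subtype.val_injective hu'
      rw [this] at hu
      have := huniq t₀ ⟨ht₀, hu⟩
      change (t₀ : BaseGaloisGroup hp) = s
      rw [this]
  haveI : FiniteDimensional L₂ L₁ :=
    finiteDimensional_of_reps hp L₂ L₁ S' hS'M fun h hh => (hrep' h hh).exists.imp fun s hs => hs
  obtain ⟨y, hy, hyn⟩ := h9 L₂ L₁ hKinf inferInstance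
  refine ⟨((y : NormedAlgClosure F) : CompletedAlgClosure F), ?_, ?_, ?_⟩
  · -- fixed by `H₁`
    intro u hu
    have hmem : ((u : BaseGaloisGroup hp)) ∈ H₁' := ⟨u, hu, rfl⟩
    rw [← hfix₁, IntermediateField.mem_fixingSubgroup_iff] at hmem
    change ((u : BaseGaloisGroup hp)) • ((y : NormedAlgClosure F) : CompletedAlgClosure F) = _
    rw [CompletedAlgClosure.base_smul_coe, BaseGaloisGroup.smul_def, hmem _ y.2]
  · rw [UniformSpace.Completion.norm_coe]; exact hyn
  · have hsum := sum_smul_eq_trace hp L₂ L₁ S' hS'M hrep' y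
    rw [hy] at hsum
    have hsum' : ∑ s ∈ S, (s : BaseGaloisGroup hp) • (y : NormedAlgClosure F) = 1 := by
      rw [hS', Finset.sum_map] at hsum
      simpa using hsum
    have hcoe : (((∑ s ∈ S, (s : BaseGaloisGroup hp) • (y : NormedAlgClosure F) : NormedAlgClosure F)) :
        CompletedAlgClosure F) = ∑ s ∈ S, ((((s : BaseGaloisGroup hp) • (y : NormedAlgClosure F) :
          NormedAlgClosure F)) : CompletedAlgClosure F) :=
      map_sum (UniformSpace.Completion.coeRingHom (α := NormedAlgClosure F)) _ _
    calc ∑ s ∈ S, s • ((y : NormedAlgClosure F) : CompletedAlgClosure F)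
        = ∑ s ∈ S, ((((s : BaseGaloisGroup hp) • (y : NormedAlgClosure F) : NormedAlgClosure F)) :
            CompletedAlgClosure F) := by
          refine Finset.sum_congr rfl fun s _ => ?_
          change ((s : BaseGaloisGroup hp)) • ((y : NormedAlgClosure F) : CompletedAlgClosure F) = _
          rw [CompletedAlgClosure.base_smul_coe]
      _ = (((∑ s ∈ S, (s : BaseGaloisGroup hp) • (y : NormedAlgClosure F) : NormedAlgClosure F)) :
            CompletedAlgClosure F) := hcoe.symm
      _ = 1 := by rw [hsum', UniformSpace.Completion.coe_one]

/-- **The named fact `tate1967_TS1_completedAlgClosure` follows from Tate's almost étale lemma**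
(Prop. 9 in trace form, for every `p`-adic field `F`): the cite-only Tate–Sen axiom (TS1) of the tree is
reduced BY NAME to `∀ F, ∀ K_∞ ⊆ L₂ ⊆ L₁ ⊆ F̄` finite, `∃ y ∈ L₁`, `Tr_{L₁/L₂} y = 1`, `‖y‖ ≤ ‖p‖⁻¹`.
[cite: Tate1967, §3.2 Prop. 9] [cite: BergerColmez2008, Déf. 3.1.3, Prop. 4.1.1] -/
theorem tate1967_TS1_of_almostEtale
    (h9 : ∀ {F : Type} [Field F] [ValuativeRel F] [TopologicalSpace F] [IsNonarchimedeanLocalField F]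
      [CharZero F] {p : ℕ} [Fact p.Prime] (hp : valuation F p < 1)
      (L₂ : IntermediateField (PadicBase F p hp) (NormedAlgClosure F))
      (L₁ : IntermediateField L₂ (NormedAlgClosure F)), TateTrace.Kinf hp ≤ L₂ →
      FiniteDimensional L₂ L₁ → ∃ y : L₁, Algebra.trace L₂ L₁ y = 1 ∧
        ‖(y : NormedAlgClosure F)‖ ≤ ‖(p : NormedAlgClosure F)‖⁻¹) :
    tate1967_TS1_completedAlgClosure :=
  fun hp => TS1_of_almostEtale hp (h9 hp)

/-- **(TS1) for `ℂ_F` from the almost étale lemma over FINITE bases.** As `TS1_of_almostEtale`, but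
Tate's Prop. 9 (trace form) is only required for bases `L₂ ⊇ K_∞` FINITE over `K_∞` — all the bridge ever
uses: `L₂ = F̄^{H₂}` with `H₂` open in the compact `H₀`, so `H₀/H₂` is finite and
`finiteDimensional_of_reps` applies over `K_∞`. This is the form the Sylow dévissage delivers.
[cite: Tate1967, §3.2 Prop. 9] [cite: BergerColmez2008, Déf. 3.1.3, Prop. 4.1.1] -/
theorem TS1_of_almostEtale_fin
    (h9 : ∀ (L₂ : IntermediateField (PadicBase F p hp) (NormedAlgClosure F))
      (hK : TateTrace.Kinf hp ≤ L₂), FiniteDimensional (TateTrace.Kinf hp) (extendScalars hK) →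
      ∀ (L₁ : IntermediateField L₂ (NormedAlgClosure F)),
      FiniteDimensional L₂ L₁ → ∃ y : L₁, Algebra.trace L₂ L₁ y = 1 ∧
        ‖(y : NormedAlgClosure F)‖ ≤ ‖(p : NormedAlgClosure F)‖⁻¹) :
    ∃ K : ℝ, ∀ (H₁ H₂ : OpenSubgroup (BaseGaloisGroup.baseCyclotomicCharacter hp).ker), H₁ ≤ H₂ →
      ∀ S : Finset (BaseGaloisGroup.baseCyclotomicCharacter hp).ker,
        (∀ s ∈ S, s ∈ H₂) → (∀ h ∈ H₂, ∃! s, s ∈ S ∧ s⁻¹ * h ∈ H₁) →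
        ∃ α : CompletedAlgClosure F, (∀ u ∈ H₁, u • α = α) ∧ ‖α‖ ≤ K ∧ ∑ s ∈ S, s • α = 1 := by
  classical
  haveI : IsGalois (PadicBase F p hp) (NormedAlgClosure F) := inferInstance
  set Hk := (BaseGaloisGroup.baseCyclotomicCharacter hp).ker with hHk
  refine ⟨‖(p : NormedAlgClosure F)‖⁻¹, fun H₁ H₂ h12 S hS hrep => ?_⟩
  -- the subgroups in `G₀` and their fixed fields
  set H₁' : Subgroup (BaseGaloisGroup hp) := H₁.toSubgroup.map Hk.subtype with hH₁'
  set H₂' : Subgroup (BaseGaloisGroup hp) := H₂.toSubgroup.map Hk.subtype with hH₂'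
  have h12' : H₁' ≤ H₂' := Subgroup.map_mono h12
  -- closedness: `Hk` is closed in `G₀`, `H_i` are closed in `Hk`
  have hHkcl : IsClosed (Hk : Set (BaseGaloisGroup hp)) := by
    have h : (Hk : Set (BaseGaloisGroup hp)) = (BaseGaloisGroup.baseCyclotomicCharacter hp) ⁻¹' {1} := by
      ext g; exact MonoidHom.mem_ker
    rw [h]
    exact isClosed_singleton.preimage
      (cyclotomicCharacter.continuous p (PadicBase F p hp) (NormedAlgClosure F))
  have hclosed : ∀ H : OpenSubgroup Hk, IsClosed ((H.toSubgroup.map Hk.subtype : Subgroup _) :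
      Set (BaseGaloisGroup hp)) := by
    intro H
    have h1 : IsClosed (H : Set Hk) := H.isClosed
    have h2 : ((H.toSubgroup.map Hk.subtype : Subgroup (BaseGaloisGroup hp)) : Set (BaseGaloisGroup hp)) =
        ((↑) : Hk → BaseGaloisGroup hp) '' (H : Set Hk) := by
      ext g; simp
    rw [h2]
    exact (hHkcl.isClosedEmbedding_subtypeVal.isClosedMap) _ h1
  set L₂ : IntermediateField (PadicBase F p hp) (NormedAlgClosure F) := fixedField H₂' with hL₂
  set L₁E : IntermediateField (PadicBase F p hp) (NormedAlgClosure F) := fixedField H₁' with hL₁E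
  have hle : L₂ ≤ L₁E := IntermediateField.fixedField_le h12'
  set L₁ : IntermediateField L₂ (NormedAlgClosure F) := extendScalars hle with hL₁
  have hfix₂ : L₂.fixingSubgroup = H₂' :=
    InfiniteGalois.fixingSubgroup_fixedField ⟨H₂', hclosed H₂⟩
  have hfix₁ : L₁E.fixingSubgroup = H₁' :=
    InfiniteGalois.fixingSubgroup_fixedField ⟨H₁', hclosed H₁⟩
  -- `K_∞ ≤ L₂`
  have hKinf : TateTrace.Kinf hp ≤ L₂ := by
    intro x hx
    rw [hL₂, IntermediateField.mem_fixedField_iff]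
    rintro g ⟨g₀, -, rfl⟩
    have hg₀ : (g₀ : BaseGaloisGroup hp) ∈ Hk := g₀.2
    rw [TateSen.mem_baseKer_iff_forall_smul_zeta] at hg₀
    exact (TateTrace.forall_mem_Kinf_smul_eq_iff hp _).mpr hg₀ x hx
  -- the system of representatives in `G₀`
  set S' : Finset (BaseGaloisGroup hp) := S.map ⟨((↑) : Hk → BaseGaloisGroup hp), Subtype.val_injective⟩
    with hS'
  have hS'M : ∀ s ∈ S', ∀ y ∈ L₂, s • y = y := by
    intro s hs y hy
    obtain ⟨s₀, hs₀, rfl⟩ := Finset.mem_map.mp hs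
    have : ((s₀ : BaseGaloisGroup hp)) ∈ H₂' := ⟨s₀, hS s₀ hs₀, rfl⟩
    rw [hL₂, IntermediateField.mem_fixedField_iff] at hy
    exact hy _ this
  have hrep' : ∀ h : BaseGaloisGroup hp, (∀ y ∈ L₂, h • y = y) →
      ∃! s, s ∈ S' ∧ ∀ z ∈ L₁, (s⁻¹ * h) • z = z := by
    intro h hh
    have hh2 : h ∈ H₂' := by
      rw [← hfix₂, IntermediateField.mem_fixingSubgroup_iff]; exact hh
    obtain ⟨h₀, hh₀, rfl⟩ := hh2
    obtain ⟨s, ⟨hsS, hs⟩, huniq⟩ := hrep h₀ hh₀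
    refine ⟨(s : BaseGaloisGroup hp), ⟨Finset.mem_map.mpr ⟨s, hsS, rfl⟩, ?_⟩, ?_⟩
    · intro z hz
      have hmem : ((s⁻¹ * h₀ : Hk) : BaseGaloisGroup hp) ∈ H₁' := ⟨s⁻¹ * h₀, hs, rfl⟩
      rw [← hfix₁, IntermediateField.mem_fixingSubgroup_iff] at hmem
      exact hmem z hz
    · intro t ⟨ht, htfix⟩
      obtain ⟨t₀, ht₀, rfl⟩ := Finset.mem_map.mp ht
      have hmem : ((t₀⁻¹ * h₀ : Hk) : BaseGaloisGroup hp) ∈ L₁E.fixingSubgroup := by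
        rw [IntermediateField.mem_fixingSubgroup_iff]
        intro z hz; exact htfix z hz
      rw [hfix₁] at hmem
      obtain ⟨u, hu, hu'⟩ := hmem
      have : u = t₀⁻¹ * h₀ := Subtype.val_injective hu'
      rw [this] at hu
      have := huniq t₀ ⟨ht₀, hu⟩
      change (t₀ : BaseGaloisGroup hp) = s
      rw [this]
  haveI : FiniteDimensional L₂ L₁ :=
    finiteDimensional_of_reps hp L₂ L₁ S' hS'M fun h hh => (hrep' h hh).exists.imp fun s hs => hs
  -- `L₂` is finite over `K_∞`: `H₂` has finite index in the compact `H₀`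
  haveI : CompactSpace Hk := isCompact_iff_compactSpace.mp hHkcl.isCompact
  haveI : Fintype (Hk ⧸ H₂.toSubgroup) := Fintype.ofFinite _
  set S₀ : Finset (BaseGaloisGroup hp) :=
    Finset.univ.image (fun q : Hk ⧸ H₂.toSubgroup => ((q.out : Hk) : BaseGaloisGroup hp)) with hS₀
  have hfixK : ∀ g : BaseGaloisGroup hp, g ∈ Hk ↔ ∀ y ∈ TateTrace.Kinf hp, g • y = y := by
    intro g
    rw [TateSen.mem_baseKer_iff_forall_smul_zeta, TateTrace.forall_mem_Kinf_smul_eq_iff]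
  have hS₀M : ∀ s ∈ S₀, ∀ y ∈ TateTrace.Kinf hp, s • y = y := by
    intro s hs
    obtain ⟨q, -, rfl⟩ := Finset.mem_image.mp hs
    exact (hfixK _).mp (q.out).2
  have hrep₀ : ∀ h : BaseGaloisGroup hp, (∀ y ∈ TateTrace.Kinf hp, h • y = y) →
      ∃ s, s ∈ S₀ ∧ ∀ z ∈ extendScalars hKinf, (s⁻¹ * h) • z = z := by
    intro h hh
    have hmem : h ∈ Hk := (hfixK h).mpr hh
    set h₀ : Hk := ⟨h, hmem⟩ with hh₀
    refine ⟨((QuotientGroup.mk h₀ : Hk ⧸ H₂.toSubgroup).out : Hk), Finset.mem_image.mpr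
      ⟨QuotientGroup.mk h₀, Finset.mem_univ _, rfl⟩, ?_⟩
    have hq : ((QuotientGroup.mk h₀ : Hk ⧸ H₂.toSubgroup).out)⁻¹ * h₀ ∈ H₂.toSubgroup :=
      QuotientGroup.eq.mp (QuotientGroup.out_eq' (QuotientGroup.mk h₀ : Hk ⧸ H₂.toSubgroup))
    have hmem' : ((((QuotientGroup.mk h₀ : Hk ⧸ H₂.toSubgroup).out)⁻¹ * h₀ : Hk) : BaseGaloisGroup hp) ∈
        H₂' := ⟨_, hq, rfl⟩
    rw [← hfix₂, IntermediateField.mem_fixingSubgroup_iff] at hmem'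
    intro z hz
    exact hmem' z hz
  haveI : FiniteDimensional (TateTrace.Kinf hp) (extendScalars hKinf) :=
    finiteDimensional_of_reps hp (TateTrace.Kinf hp) (extendScalars hKinf) S₀ hS₀M hrep₀
  obtain ⟨y, hy, hyn⟩ := h9 L₂ hKinf inferInstance L₁ inferInstance
  refine ⟨((y : NormedAlgClosure F) : CompletedAlgClosure F), ?_, ?_, ?_⟩
  · -- fixed by `H₁`
    intro u hu
    have hmem : ((u : BaseGaloisGroup hp)) ∈ H₁' := ⟨u, hu, rfl⟩
    rw [← hfix₁, IntermediateField.mem_fixingSubgroup_iff] at hmem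
    change ((u : BaseGaloisGroup hp)) • ((y : NormedAlgClosure F) : CompletedAlgClosure F) = _
    rw [CompletedAlgClosure.base_smul_coe, BaseGaloisGroup.smul_def, hmem _ y.2]
  · rw [UniformSpace.Completion.norm_coe]; exact hyn
  · have hsum := sum_smul_eq_trace hp L₂ L₁ S' hS'M hrep' y
    rw [hy] at hsum
    have hsum' : ∑ s ∈ S, (s : BaseGaloisGroup hp) • (y : NormedAlgClosure F) = 1 := by
      rw [hS', Finset.sum_map] at hsum
      simpa using hsum
    have hcoe : (((∑ s ∈ S, (s : BaseGaloisGroup hp) • (y : NormedAlgClosure F) : NormedAlgClosure F)) :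
        CompletedAlgClosure F) = ∑ s ∈ S, ((((s : BaseGaloisGroup hp) • (y : NormedAlgClosure F) :
          NormedAlgClosure F)) : CompletedAlgClosure F) :=
      map_sum (UniformSpace.Completion.coeRingHom (α := NormedAlgClosure F)) _ _
    calc ∑ s ∈ S, s • ((y : NormedAlgClosure F) : CompletedAlgClosure F)
        = ∑ s ∈ S, ((((s : BaseGaloisGroup hp) • (y : NormedAlgClosure F) : NormedAlgClosure F)) :
            CompletedAlgClosure F) := by
          refine Finset.sum_congr rfl fun s _ => ?_
          change ((s : BaseGaloisGroup hp)) • ((y : NormedAlgClosure F) : CompletedAlgClosure F) = _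
          rw [CompletedAlgClosure.base_smul_coe]
      _ = (((∑ s ∈ S, (s : BaseGaloisGroup hp) • (y : NormedAlgClosure F) : NormedAlgClosure F)) :
            CompletedAlgClosure F) := hcoe.symm
      _ = 1 := by rw [hsum', UniformSpace.Completion.coe_one]


/-- **The named fact from Prop. 9 over finite bases** (all `p`-adic `F`): by-name reduction of the
cite-only `tate1967_TS1_completedAlgClosure` to Tate's almost étale lemma in trace form for
`K_∞ ⊆ L₂ ⊆ L₁ ⊆ F̄` with `L₂/K_∞` and `L₁/L₂` finite.
[cite: Tate1967, §3.2 Prop. 9] [cite: BergerColmez2008, Déf. 3.1.3, Prop. 4.1.1] -/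
theorem tate1967_TS1_of_almostEtale_fin
    (h9 : ∀ {F : Type} [Field F] [ValuativeRel F] [TopologicalSpace F] [IsNonarchimedeanLocalField F]
      [CharZero F] {p : ℕ} [Fact p.Prime] (hp : valuation F p < 1)
      (L₂ : IntermediateField (PadicBase F p hp) (NormedAlgClosure F))
      (hK : TateTrace.Kinf hp ≤ L₂), FiniteDimensional (TateTrace.Kinf hp) (extendScalars hK) →
      ∀ (L₁ : IntermediateField L₂ (NormedAlgClosure F)),
      FiniteDimensional L₂ L₁ → ∃ y : L₁, Algebra.trace L₂ L₁ y = 1 ∧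
        ‖(y : NormedAlgClosure F)‖ ≤ ‖(p : NormedAlgClosure F)‖⁻¹) :
    tate1967_TS1_completedAlgClosure :=
  fun hp => TS1_of_almostEtale_fin hp (h9 hp)

end TS1

end TateAlmostEtale

end Literature.NumberTheory.PAdicHodge

end
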